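import Literature.NumberTheory.Automorphic.ModularLambdaSurjective
import Literature.NumberTheory.ModularForms.ModerateGrowth
import HarnessLib

/-!
# Growth of the elliptic modular function `λ` on the whole upper half-plane

`Literature/NumberTheory/Automorphic/ModularLambdaLogGrowth.lean` — PROOF-ONLY (no definition, no
named fact). For the tree's `λ`-function `Literature.NumberTheory.Automorphic.modularLambda`
(`= θ₂⁴/θ₃⁴`, file `ModularLambda.lean`) we prove the crude growth estimate

* ★ `exists_log_norm_modularLambda_le` — there is `C` with `log ‖λ(τ)‖ ≤ C + π (Im τ + 1/Im τ)`
  for every `τ` with `Im τ > 0`,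

i.e. `|λ(τ)| ≤ e^{C} e^{π/Im τ} e^{π Im τ}` (classical: `λ` is bounded on `Im τ ≥ 1/2` away from
the cusps, blows up like `e^{π Im τ'}/16` at the cusps `±1`, and every point is `SL₂(ℤ)`-equivalent
to one with `Im ≥ 1/2`; L. V. Ahlfors, *Complex Analysis*, Ch. 7 §3.4). Steps:

* (private) `modularLambda_add_two_mul_natCast`, `modularLambda_add_two_mul_intCast` — the period `2`
  (also available as `Literature.Analysis.Complex.GreatPicard.modularLambda_add_two_mul_int`, whose
  module is not importable here without a heavy manifold dependency);
* `exists_bounds_modularLambda_of_half_le_im` — `‖λ‖ ≤ A`, `‖λ⁻¹‖ ≤ A e^{π Im τ}`,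
  `‖(1 − λ)⁻¹‖ ≤ A` on `Im τ ≥ 1/2` (the asymptotics `e^{−πiτ}λ(τ) → 16`, `λ(τ) → 0` of
  `ModularLambda.lean` high up; continuity, `λ ≠ 0, 1` and the period on the compact rest);
* `im_smul_le_im_add_inv` — `Im(γ • z) ≤ Im z + 1/Im z` for `γ ∈ SL₂(ℤ)` (from the tree's
  `min 1 (Im z) ≤ |cz + d|`, file `ModularForms/ModerateGrowth.lean`);
* ★ from Mathlib's `ModularGroup.exists_one_half_le_im_smul` and the anharmonic six
  `modularLambda_smul_eq_or` (file `ModularLambdaSurjective.lean`).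

Consumer: the quantitative Schottky theorem `Literature/Analysis/Complex/SchottkyQuantitative.lean`
(hence the unconditional form of Calegari–Dimitrov–Tang's Theorem 6.0.1). The finer statement
`log λ ∈ 𝓟` (moderate growth of the holomorphic logarithm) is the tree's
`Literature.NumberTheory.ModularForms.isClassP_logLambda`; the present file is independent of it.

## References
* [Ahlfors1979] L. V. Ahlfors, *Complex Analysis*, 3rd ed. (1979), Ch. 7 §3.4.
-/

noncomputable section

open Complex Real Filter Metric Set
open UpperHalfPlane hiding I

open scoped Real Topology MatrixGroups

namespace Literature.NumberTheory.Automorphic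

namespace ModularLambda

/-! ### 1. Growth of `λ` on the upper half-plane -/

/-- `λ(τ + 2n) = λ(τ)` for `n : ℕ` (`λ` has period `2`). [cite: Ahlfors1979, Ch. 7 §3.4] -/
private theorem modularLambda_add_two_mul_natCast (τ : ℂ) (n : ℕ) :
    modularLambda (τ + 2 * n) = modularLambda τ := by
  induction n with
  | zero => simp
  | succ n ih =>
    rw [show τ + 2 * ((n + 1 : ℕ) : ℂ) = (τ + 2 * n) + 2 by push_cast; ring, modularLambda_add_two,
      ih]

/-- `λ(τ + 2n) = λ(τ)` for `n : ℤ` (`λ` has period `2`). [cite: Ahlfors1979, Ch. 7 §3.4] -/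
private theorem modularLambda_add_two_mul_intCast (τ : ℂ) (n : ℤ) :
    modularLambda (τ + 2 * n) = modularLambda τ := by
  obtain ⟨k, rfl | rfl⟩ := Int.eq_nat_or_neg n
  · exact_mod_cast modularLambda_add_two_mul_natCast τ k
  · have h := modularLambda_add_two_mul_natCast (τ + 2 * ((-(k : ℤ) : ℤ) : ℂ)) k
    rw [show τ + 2 * ((-(k : ℤ) : ℤ) : ℂ) + 2 * (k : ℂ) = τ by push_cast; ring] at h
    exact h.symm

/-- **Bounds for `λ`, `1/λ`, `1/(1 − λ)` on `Im τ ≥ 1/2`**: there is `A > 0` with `‖λ τ‖ ≤ A`,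
`‖(λ τ)⁻¹‖ ≤ A e^{π Im τ}` and `‖(1 − λ τ)⁻¹‖ ≤ A` whenever `Im τ ≥ 1/2` (asymptotics
`e^{−πiτ} λ(τ) → 16`, `λ → 0` at `i∞`; continuity, nonvanishing of `λ` and `1 − λ`, and the
period `2` on the compact part). [cite: Ahlfors1979, Ch. 7 §3.4] -/
theorem exists_bounds_modularLambda_of_half_le_im :
    ∃ A : ℝ, 0 < A ∧ ∀ τ : ℂ, 1 / 2 ≤ τ.im →
      ‖modularLambda τ‖ ≤ A ∧ ‖(modularLambda τ)⁻¹‖ ≤ A * Real.exp (π * τ.im) ∧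
        ‖(1 - modularLambda τ)⁻¹‖ ≤ A := by
  -- asymptotics at `i∞`
  have hev : ∀ᶠ τ : ℂ in comap Complex.im atTop,
      Complex.exp (-(π * I * τ)) * modularLambda τ ∈ ball (16 : ℂ) 1 :=
    tendsto_exp_mul_modularLambda (ball_mem_nhds _ one_pos)
  obtain ⟨B₁, hB₁⟩ := eventually_atTop.mp (Filter.eventually_comap.mp hev)
  obtain ⟨B₂, hB₂⟩ := exists_forall_norm_modularLambda_lt (by norm_num : (0 : ℝ) < 1 / 2)
  set B : ℝ := max (max B₁ B₂) 1 with hB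
  have hBB₁ : B₁ ≤ B := (le_max_left _ _).trans (le_max_left _ _)
  have hBB₂ : B₂ ≤ B := (le_max_right _ _).trans (le_max_left _ _)
  have hB1 : (1 : ℝ) ≤ B := le_max_right _ _
  -- the compact part
  set K : Set ℂ := {τ : ℂ | |τ.re| ≤ 1 ∧ 1 / 2 ≤ τ.im ∧ τ.im ≤ B} with hK
  have hKsub : K ⊆ {z : ℂ | 0 < z.im} := fun τ hτ ↦ lt_of_lt_of_le one_half_pos hτ.2.1
  have hKc : IsCompact K := by
    refine Metric.isCompact_of_isClosed_isBounded ?_ ?_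
    · refine (isClosed_le (continuous_abs.comp Complex.continuous_re) continuous_const).inter
        ((isClosed_le continuous_const Complex.continuous_im).inter
          (isClosed_le Complex.continuous_im continuous_const))
    · refine (isBounded_iff_forall_norm_le).2 ⟨1 + B, fun τ hτ ↦ ?_⟩
      calc ‖τ‖ ≤ |τ.re| + |τ.im| := Complex.norm_le_abs_re_add_abs_im τ
        _ ≤ 1 + B := by
            rw [abs_of_pos (lt_of_lt_of_le one_half_pos hτ.2.1)]
            linarith [hτ.1, hτ.2.2]
  have hcont : ContinuousOn modularLambda K := continuousOn_modularLambda.mono hKsub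
  have hcont₂ : ContinuousOn (fun τ ↦ (modularLambda τ)⁻¹) K :=
    hcont.inv₀ fun τ hτ ↦ modularLambda_ne_zero (hKsub hτ)
  have hcont₃ : ContinuousOn (fun τ ↦ (1 - modularLambda τ)⁻¹) K :=
    (continuousOn_const.sub hcont).inv₀ fun τ hτ ↦ sub_ne_zero.2 (modularLambda_ne_one (hKsub hτ)).symm
  obtain ⟨M₁, hM₁⟩ := hKc.exists_bound_of_continuousOn hcont
  obtain ⟨M₂, hM₂⟩ := hKc.exists_bound_of_continuousOn hcont₂
  obtain ⟨M₃, hM₃⟩ := hKc.exists_bound_of_continuousOn hcont₃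
  refine ⟨|M₁| + |M₂| + |M₃| + 17, by positivity, fun τ hτ ↦ ?_⟩
  have hτ0 : 0 < τ.im := lt_of_lt_of_le one_half_pos hτ
  have hexp1 : 1 ≤ Real.exp (π * τ.im) := Real.one_le_exp (by positivity)
  by_cases hτB : B ≤ τ.im
  · -- high in the upper half-plane: asymptotics
    have h1 := hB₁ τ.im (hBB₁.trans hτB) τ rfl
    rw [mem_ball, dist_eq_norm] at h1
    have hE : ‖Complex.exp (-(π * I * τ))‖ = Real.exp (π * τ.im) := by
      rw [Complex.norm_exp]
      congr 1
      simp [Complex.mul_re, Complex.mul_im, Complex.I_re, Complex.I_im]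
    -- `15 < e^{π Im τ} ‖λ τ‖ < 17`
    have hup : Real.exp (π * τ.im) * ‖modularLambda τ‖ ≤ 17 := by
      have h' : ‖Complex.exp (-(π * I * τ)) * modularLambda τ‖ ≤ ‖(16 : ℂ)‖ + 1 := by
        have := norm_sub_norm_le (Complex.exp (-(π * I * τ)) * modularLambda τ) 16
        linarith
      rw [norm_mul, hE] at h'
      have h16 : ‖(16 : ℂ)‖ = 16 := by norm_num
      linarith
    have hlow : 15 ≤ Real.exp (π * τ.im) * ‖modularLambda τ‖ := by
      have h' : ‖(16 : ℂ)‖ - 1 ≤ ‖Complex.exp (-(π * I * τ)) * modularLambda τ‖ := by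
        have := norm_sub_norm_le (16 : ℂ) (Complex.exp (-(π * I * τ)) * modularLambda τ)
        rw [norm_sub_rev] at this
        linarith
      rw [norm_mul, hE] at h'
      have h16 : ‖(16 : ℂ)‖ = 16 := by norm_num
      linarith
    have hlampos : 0 < ‖modularLambda τ‖ := norm_pos_iff.2 (modularLambda_ne_zero hτ0)
    refine ⟨?_, ?_, ?_⟩
    · -- `‖λ‖ ≤ 17 e^{-π Im} ≤ 17`
      have : ‖modularLambda τ‖ ≤ 17 := by nlinarith
      linarith [abs_nonneg M₁, abs_nonneg M₂, abs_nonneg M₃]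
    · rw [norm_inv, inv_le_iff_one_le_mul₀ hlampos]
      nlinarith [abs_nonneg M₁, abs_nonneg M₂, abs_nonneg M₃]
    · have h2 := hB₂ τ (hBB₂.trans hτB)
      have h1l : 1 / 2 ≤ ‖1 - modularLambda τ‖ := by
        have := norm_sub_norm_le (1 : ℂ) (modularLambda τ)
        rw [norm_one] at this
        linarith
      rw [norm_inv, inv_le_comm₀ (lt_of_lt_of_le one_half_pos h1l) (by positivity)]
      have : (|M₁| + |M₂| + |M₃| + 17)⁻¹ ≤ (17 : ℝ)⁻¹ :=
        inv_anti₀ (by norm_num) (by linarith [abs_nonneg M₁, abs_nonneg M₂, abs_nonneg M₃])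
      linarith [show (17 : ℝ)⁻¹ ≤ 1 / 2 by norm_num]
  · -- the compact part, after a translation by an even integer
    rw [not_le] at hτB
    set k : ℤ := ⌊(τ.re + 1) / 2⌋ with hk
    set τ₁ : ℂ := τ + 2 * ((-k : ℤ) : ℂ) with hτ₁
    have hlam : modularLambda τ₁ = modularLambda τ := modularLambda_add_two_mul_intCast τ (-k)
    have hre : τ₁.re = τ.re - 2 * k := by simp [hτ₁]; ring
    have him : τ₁.im = τ.im := by simp [hτ₁]
    have hK₁ : τ₁ ∈ K := by
      refine ⟨?_, by rw [him]; exact hτ, by rw [him]; exact hτB.le⟩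
      rw [hre, abs_le]
      have h1 := Int.floor_le ((τ.re + 1) / 2)
      have h2 := Int.lt_floor_add_one ((τ.re + 1) / 2)
      rw [← hk] at h1 h2
      constructor <;> linarith
    refine ⟨?_, ?_, ?_⟩
    · rw [← hlam]
      linarith [hM₁ τ₁ hK₁, le_abs_self M₁, abs_nonneg M₂, abs_nonneg M₃]
    · rw [← hlam]
      have h := hM₂ τ₁ hK₁
      calc ‖(modularLambda τ₁)⁻¹‖ ≤ |M₂| := h.trans (le_abs_self _)
        _ ≤ (|M₁| + |M₂| + |M₃| + 17) * 1 := by linarith [abs_nonneg M₁, abs_nonneg M₃]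
        _ ≤ (|M₁| + |M₂| + |M₃| + 17) * Real.exp (π * τ.im) := by gcongr
    · rw [← hlam]
      have h := hM₃ τ₁ hK₁
      linarith [le_abs_self M₃, abs_nonneg M₁, abs_nonneg M₂]

/-- `Im(γ • z) ≤ Im z + 1/Im z` for `γ ∈ SL₂(ℤ)` (`|cz + d| ≥ min(1, Im z)`). [folklore] -/
private theorem im_smul_le_im_add_inv (γ : SL(2, ℤ)) (z : ℍ) :
    (γ • z).im ≤ z.im + z.im⁻¹ := by
  have hz : 0 < z.im := z.im_pos
  have hd := Literature.NumberTheory.ModularForms.min_one_im_le_norm_denom γ z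
  have hdpos : 0 < ‖UpperHalfPlane.denom (γ : GL (Fin 2) ℝ) z‖ :=
    norm_pos_iff.2 (UpperHalfPlane.denom_ne_zero _ _)
  rw [ModularGroup.im_smul_eq_div_normSq, Complex.normSq_eq_norm_sq]
  have hmin : 0 < min 1 z.im := lt_min one_pos hz
  have hsq : (min 1 z.im) ^ 2 ≤ ‖UpperHalfPlane.denom (γ : GL (Fin 2) ℝ) z‖ ^ 2 :=
    pow_le_pow_left₀ hmin.le hd 2
  calc z.im / ‖UpperHalfPlane.denom (γ : GL (Fin 2) ℝ) z‖ ^ 2 ≤ z.im / (min 1 z.im) ^ 2 :=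
        div_le_div_of_nonneg_left hz.le (pow_pos hmin 2) hsq
    _ ≤ z.im + z.im⁻¹ := by
        rcases le_total 1 z.im with h1 | h1
        · rw [min_eq_left h1, one_pow, div_one]
          linarith [inv_pos.2 hz]
        · rw [min_eq_right h1, sq, div_mul_cancel_right₀ hz.ne' z.im, ← one_div, one_div]
          linarith

/-- **Growth of `log |λ|` on the upper half-plane**: there is `C` with
`log ‖λ(τ)‖ ≤ C + π (Im τ + 1/Im τ)` for every `τ` with `Im τ > 0` (move `τ` to `Im ≥ 1/2` by
`SL₂(ℤ)`; `λ` changes by one of the six anharmonic substitutions). [cite: Ahlfors1979, Ch. 7 §3.4] -/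
theorem exists_log_norm_modularLambda_le :
    ∃ C : ℝ, ∀ τ : ℂ, 0 < τ.im →
      Real.log ‖modularLambda τ‖ ≤ C + π * (τ.im + τ.im⁻¹) := by
  obtain ⟨A, hA, hbd⟩ := exists_bounds_modularLambda_of_half_le_im
  refine ⟨Real.log (1 + A), fun τ hτ ↦ ?_⟩
  set z : ℍ := ⟨τ, hτ⟩ with hz
  obtain ⟨γ, hγ⟩ := ModularGroup.exists_one_half_le_im_smul z
  set τ' : ℂ := ((γ • z : ℍ) : ℂ) with hτ'
  have hτ'im : τ'.im = (γ • z).im := rfl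
  have him' : 1 / 2 ≤ τ'.im := by rw [hτ'im]; exact hγ
  have him'le : τ'.im ≤ τ.im + τ.im⁻¹ := by rw [hτ'im]; exact im_smul_le_im_add_inv γ z
  obtain ⟨h1, h2, h3⟩ := hbd τ' him'
  have hexp1 : 1 ≤ Real.exp (π * τ'.im) := Real.one_le_exp (by positivity)
  -- `λ z` is an anharmonic transform of `w = λ τ'`
  have hsix := modularLambda_smul_eq_or γ⁻¹ (γ • z)
  rw [inv_smul_smul] at hsix
  have hzτ : modularLambda ((z : ℍ) : ℂ) = modularLambda τ := rfl
  rw [hzτ] at hsix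
  -- the bound `‖λ τ‖ ≤ (1 + A) e^{π Im τ'}`
  have hbound : ‖modularLambda τ‖ ≤ (1 + A) * Real.exp (π * τ'.im) := by
    have hA1 : A ≤ (1 + A) * Real.exp (π * τ'.im) := by nlinarith
    have hA2 : 1 + A ≤ (1 + A) * Real.exp (π * τ'.im) := by nlinarith
    have hA3 : 1 + A * Real.exp (π * τ'.im) ≤ (1 + A) * Real.exp (π * τ'.im) := by nlinarith
    rcases hsix with h | h | h | h | h | h <;> rw [h]
    · exact h1.trans hA1
    · calc ‖1 - modularLambda τ'‖ ≤ ‖(1 : ℂ)‖ + ‖modularLambda τ'‖ := norm_sub_le _ _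
        _ ≤ 1 + A := by rw [norm_one]; linarith
        _ ≤ _ := hA2
    · exact h2.trans (by nlinarith)
    · exact h3.trans hA1
    · calc ‖1 - (modularLambda τ')⁻¹‖ ≤ ‖(1 : ℂ)‖ + ‖(modularLambda τ')⁻¹‖ := norm_sub_le _ _
        _ ≤ 1 + A * Real.exp (π * τ'.im) := by rw [norm_one]; linarith
        _ ≤ _ := hA3
    · calc ‖1 - (1 - modularLambda τ')⁻¹‖ ≤ ‖(1 : ℂ)‖ + ‖(1 - modularLambda τ')⁻¹‖ := norm_sub_le _ _
        _ ≤ 1 + A := by rw [norm_one]; linarith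
        _ ≤ _ := hA2
  have hpos : 0 < ‖modularLambda τ‖ := norm_pos_iff.2 (modularLambda_ne_zero hτ)
  calc Real.log ‖modularLambda τ‖ ≤ Real.log ((1 + A) * Real.exp (π * τ'.im)) :=
        Real.log_le_log hpos hbound
    _ = Real.log (1 + A) + π * τ'.im := by
        rw [Real.log_mul (by positivity) (Real.exp_pos _).ne', Real.log_exp]
    _ ≤ Real.log (1 + A) + π * (τ.im + τ.im⁻¹) := by gcongr

end ModularLambda

end Literature.NumberTheory.Automorphic

end
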